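import Summits.MatrixMultiplication.MatrixMultiplication.Statement
import Summits.MatrixMultiplication.MatrixMultiplication.Theorems.TetrahedronTensorCore
import Literature.Computability.AlgebraicComplexity.FlatteningBound
import HarnessLib

/-!
# TetrahedronTensor — the triangle cover `ω(K₄) ≤ 2ω` (CVZ19 Prop. 1.1.26, re-proved) and the exact
cut `ω = 2 ⟺ [ω(K₄) ≤ 4] ∧ [2ω ≤ ω(K₄)]`

(decomp-mm lens 6 «barrier-complement carving», gen 13; kernel of the node `TetrahedronCarving`.
Companion of `TetrahedronTensorCore` (definitions `tetra`, `tetraAdmissibleExponents`, `omegaTetra`,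
bracket `4 ≤ ω(K₄) ≤ 6`).)

Sources: [CVZ19] Christandl–Vrana–Zuiddam, arXiv:1609.07476, Prop. 1.1.26 («`τ(T(K_k)) ≤ τ(T(K_ℓ))`
for `k ≥ ℓ ≥ 2`», here `k = 4, ℓ = 3`: the doubled tetrahedron `2·K₄` is the edge-disjoint union of
its four triangles, so `T(K₄)_{n²} ≅ T(2K₄)_n ≤ ⊗_{4 triangles} ⟨n,n,n⟩`) and §1.3 («if `ω = 2` then
`τ(T(K₃)) = τ(T(K₄)) = 2/3`»); [BCKLOSW26] Brand–Curticapean–Kaski–Li–Orzel–Seppelt–Wang,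
arXiv:2602.11975, eq. (13)–(14) (`S_d(1) + ⋯ + S_d(d) ≡ 2·K_d`, `T^{⊗d} ≤ T_{2K_d,n} ≡ T_{K_d,n²}`).

What is proved here (sorry-free): the POINTWISE TRIANGLE FACTORISATION `tetra_sq_apply` of
`T(K₄)_{n·n}` (pair labels `Fin (n·n) ≃ Fin n × Fin n` on every edge; first components routed to the
triangle with the larger missing vertex) into four matrix multiplication tensors `matMulTensor F n n n`;
the cover decomposition `tetra_sq_eq_sum_cover` (`r⁴` rank-one terms from a triad decomposition of
`⟨n,n,n⟩` of length `r`) and `tensorRankD_tetra_sq_le : R₄(T(K₄)_{n·n}) ≤ R(⟨n,n,n⟩)⁴`; level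
monotonicity `tensorRankD_tetra_mono` (pullback along leg maps); the exponent bookkeeping
`two_mul_mem_tetraAdmissibleExponents` (`β` admissible for `⟨n,n,n⟩ ⟹ 2β` admissible for `T(K₄)`)
and `omegaTetra_le_two_mul_omega : ω(K₄) ≤ 2ω` over every field; over `ℂ`, against the summit
statement `_root_.MatrixMultiplication` (`ω(ℂ) = 2`): both necessities
`omegaTetra_le_four_of_matrixMultiplication`, `two_mul_omega_le_omegaTetra_of_matrixMultiplication`,
the sufficiency `matrixMultiplication_of_tetra`, and the exactness `matrixMultiplication_iff_tetra`.
No `sorry`, no new axiom, no instance, no notation, no `Prop`-valued definition.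
-/

noncomputable section

-- D-0017 nested layout `Summits/<Summit>/<Sub>/…` with `Sub = Summit` duplicates a namespace component.
set_option linter.dupNamespace false

open scoped BigOperators
open Filter Asymptotics Module
open Literature.Computability.AlgebraicComplexity

namespace Summit.MatrixMultiplication.MatrixMultiplication.Theorems.TetrahedronTensor

/-! ## The triangle cover: `R₄(T(K₄)_{n·n}) ≤ R(⟨n,n,n⟩)⁴` and `ω(K₄) ≤ 2ω` -/

section Cover

variable {F : Type*} [Field F]

/-- First component of the `j`-th label of a leg index at the square level `n·n`
(labels `Fin (n·n) ≃ Fin n × Fin n` via `finProdFinEquiv`). -/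
def P₁ {n : ℕ} (x : Fin ((n * n) ^ 3)) (j : Fin 3) : Fin n :=
  (finProdFinEquiv.symm (finFunctionFinEquiv.symm x j)).1

/-- Second component of the `j`-th label of a leg index at the square level `n·n`. -/
def P₂ {n : ℕ} (x : Fin ((n * n) ^ 3)) (j : Fin 3) : Fin n :=
  (finProdFinEquiv.symm (finFunctionFinEquiv.symm x j)).2

/-- Product of two `{0,1}`-indicators is the indicator of the conjunction. -/
theorem ite_one_zero_mul_ite (A B : Prop) [Decidable A] [Decidable B] :
    ((if A then (1 : F) else 0) * if B then (1 : F) else 0) = if (A ∧ B) then (1 : F) else 0 := by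
  by_cases hA : A <;> by_cases hB : B <;> simp [hA, hB]

/-- **Pointwise triangle factorisation.** At the square level, with pair labels `(P₁, P₂)` on every
edge, `T(K₄)_{n·n}(i) = ∏_{t} ⟨n,n,n⟩(a_t(i), b_t(i), c_t(i))`, the product over the four
triangles `t` of `K₄` (`t` = the missing vertex; the first label component of an edge is routed to
the triangle with the larger missing vertex, the second to the other one): the doubled tetrahedron
is the edge-disjoint union of its four triangles (CVZ19 proof of Prop. 1.1.26; BCKLOSW26 (13)). (CVZ19, Prop. 1.1.26 (proof)). -/
theorem tetra_sq_apply {n : ℕ} (i : Fin 4 → Fin ((n * n) ^ 3)) :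
    tetra F (n * n) i =
      matMulTensor F n n n (P₂ (i 1) 1, P₂ (i 1) 2) (P₂ (i 2) 1, P₂ (i 2) 2) (P₂ (i 3) 2, P₂ (i 3) 1) *
      matMulTensor F n n n (P₂ (i 0) 1, P₂ (i 0) 2) (P₂ (i 2) 0, P₁ (i 2) 2) (P₁ (i 3) 2, P₂ (i 3) 0) *
      matMulTensor F n n n (P₂ (i 0) 0, P₁ (i 0) 2) (P₂ (i 1) 0, P₁ (i 1) 2) (P₁ (i 3) 1, P₁ (i 3) 0) *
      matMulTensor F n n n (P₁ (i 0) 0, P₁ (i 0) 1) (P₁ (i 1) 0, P₁ (i 1) 1) (P₁ (i 2) 1, P₁ (i 2) 0) := by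
  have e : ∀ x y : Fin (n * n), x = y ↔
      ((finProdFinEquiv.symm x).1 = (finProdFinEquiv.symm y).1 ∧
        (finProdFinEquiv.symm x).2 = (finProdFinEquiv.symm y).2) := fun x y => by
    rw [← Prod.ext_iff, Equiv.apply_eq_iff_eq]
  simp only [matMulTensor, ite_one_zero_mul_ite, tetra]
  refine if_congr ?_ rfl rfl
  simp only [consistent_iff, P₁, P₂, e]
  tauto

/-- The four legs of the cover summand indexed by `l : Fin 4 → Fin r` (one index per triangle),
built from a triad decomposition `⟨n,n,n⟩ = ∑_j w_j ⊗ u_j ⊗ v_j`: at vertex `v`, the product of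
the three factors of the triangles through `v`. (CVZ19, Prop. 1.1.26 (proof)). -/
def coverLeg {n r : ℕ} (w u v : Fin r → Fin n × Fin n → F) (l : Fin 4 → Fin r) :
    Fin 4 → Fin ((n * n) ^ 3) → F :=
  ![fun x => w (l 1) (P₂ x 1, P₂ x 2) * w (l 2) (P₂ x 0, P₁ x 2) * w (l 3) (P₁ x 0, P₁ x 1),
    fun x => w (l 0) (P₂ x 1, P₂ x 2) * u (l 2) (P₂ x 0, P₁ x 2) * u (l 3) (P₁ x 0, P₁ x 1),
    fun x => u (l 0) (P₂ x 1, P₂ x 2) * u (l 1) (P₂ x 0, P₁ x 2) * v (l 3) (P₁ x 1, P₁ x 0),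
    fun x => v (l 0) (P₂ x 2, P₂ x 1) * v (l 1) (P₁ x 2, P₂ x 0) * v (l 2) (P₁ x 1, P₁ x 0)]

/-- **The cover decomposition**: from `⟨n,n,n⟩ = ∑_{j<r} w_j ⊗ u_j ⊗ v_j`,
`T(K₄)_{n·n} = ∑_{l ∈ [r]^4} ⊗_v coverLeg_l(v)` (`r⁴` rank-one terms).
[cite: ChristandlVranaZuiddam2016, Prop. 1.1.26 (proof)] -/
theorem tetra_sq_eq_sum_cover {n r : ℕ} {w u v : Fin r → Fin n × Fin n → F}
    (hdec : matMulTensor F n n n = ∑ j, triad (w j) (u j) (v j)) :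
    ∑ l : Fin 4 → Fin r, rankOneTensor (coverLeg w u v l) = tetra F (n * n) := by
  classical
  have hMM : ∀ a b c, matMulTensor F n n n a b c = ∑ j : Fin r, w j a * u j b * v j c := by
    intro a b c
    have h := congrFun (congrFun (congrFun hdec a) b) c
    rw [h, Finset.sum_apply, Finset.sum_apply, Finset.sum_apply]
    rfl
  funext i
  -- the triangle terms at the point `i`
  let T : Fin 4 → Fin r → F := ![
    fun j => w j (P₂ (i 1) 1, P₂ (i 1) 2) * u j (P₂ (i 2) 1, P₂ (i 2) 2) * v j (P₂ (i 3) 2, P₂ (i 3) 1),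
    fun j => w j (P₂ (i 0) 1, P₂ (i 0) 2) * u j (P₂ (i 2) 0, P₁ (i 2) 2) * v j (P₁ (i 3) 2, P₂ (i 3) 0),
    fun j => w j (P₂ (i 0) 0, P₁ (i 0) 2) * u j (P₂ (i 1) 0, P₁ (i 1) 2) * v j (P₁ (i 3) 1, P₁ (i 3) 0),
    fun j => w j (P₁ (i 0) 0, P₁ (i 0) 1) * u j (P₁ (i 1) 0, P₁ (i 1) 1) * v j (P₁ (i 2) 1, P₁ (i 2) 0)]
  calc (∑ l : Fin 4 → Fin r, rankOneTensor (coverLeg w u v l)) i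
      = ∑ l : Fin 4 → Fin r, ∏ t, T t (l t) := by
        rw [Finset.sum_apply]
        refine Finset.sum_congr rfl fun l _ => ?_
        rw [rankOneTensor_apply, Fin.prod_univ_four, Fin.prod_univ_four]
        simp only [coverLeg, T, Matrix.cons_val_zero, Matrix.cons_val_one, Matrix.cons_val_two,
          Matrix.cons_val_three, Matrix.head_cons, Matrix.tail_cons]
        ring
    _ = ∏ t, ∑ j, T t j := (Fintype.prod_sum T).symm
    _ = tetra F (n * n) i := by
        rw [Fin.prod_univ_four, tetra_sq_apply, hMM, hMM, hMM, hMM]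
        simp only [T, Matrix.cons_val_zero, Matrix.cons_val_one, Matrix.cons_val_two,
          Matrix.cons_val_three, Matrix.head_cons, Matrix.tail_cons]

/-- **Cover bound** `R₄(T(K₄)_{n·n}) ≤ R(⟨n,n,n⟩)⁴` (CVZ19 Prop. 1.1.26 with `k = 4, ℓ = 3`, at a
fixed level). [cite: ChristandlVranaZuiddam2016, Prop. 1.1.26] -/
theorem tensorRankD_tetra_sq_le (n : ℕ) :
    tensorRankD (tetra F (n * n)) ≤ tensorRank (matMulTensor F n n n) ^ 4 := by
  classical
  obtain ⟨w, u, v, hdec⟩ := exists_triad_decomposition_tensorRank (matMulTensor F n n n)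
  have hsum := tetra_sq_eq_sum_cover hdec
  have hcard : Fintype.card (Fin 4 → Fin (tensorRank (matMulTensor F n n n))) =
      tensorRank (matMulTensor F n n n) ^ 4 := by simp
  rw [← hcard]
  let e := Fintype.equivFin (Fin 4 → Fin (tensorRank (matMulTensor F n n n)))
  refine tensorRankD_le_of_eq_sum (fun k => coverLeg w u v (e.symm k)) ?_
  rw [← hsum]
  exact Fintype.sum_equiv e.symm _ _ (fun _ => rfl)

/-- Rank is monotone under pullback along leg maps. [folklore] -/
theorem tensorRankD_pullback_le {d N N' : ℕ} (T : (Fin d → Fin N') → F)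
    (φ : Fin d → Fin N → Fin N')
    (hT : ∃ s : ℕ, ∃ g : Fin s → ((Fin d → Fin N') → F),
      (∀ k, g k ∈ rankOneTensors F N' d) ∧ ∑ k, g k = T) :
    tensorRankD (fun i : Fin d → Fin N => T (fun v => φ v (i v))) ≤ tensorRankD T := by
  classical
  obtain ⟨g, hg, hsum⟩ := sComplexity_spec hT
  simp only [rankOneTensors, Set.mem_range] at hg
  choose u hu using hg
  refine tensorRankD_le_of_eq_sum (fun k v x => u k v (φ v x)) ?_
  funext i
  have h := congrFun hsum (fun v => φ v (i v))
  rw [Finset.sum_apply] at h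
  rw [Finset.sum_apply, ← h]
  refine Finset.sum_congr rfl fun k _ => ?_
  rw [← hu k, rankOneTensor_apply, rankOneTensor_apply]

/-- `T(K₄)_m` is the pullback of `T(K₄)_{m'}` along the label embedding `Fin m ↪ Fin m'`
(`m ≤ m'`). [folklore] -/
theorem tetra_eq_pullback {m m' : ℕ} (h : m ≤ m') :
    tetra F m = fun i : Fin 4 → Fin (m ^ 3) =>
      tetra F m' (fun v => finFunctionFinEquiv (fun j => Fin.castLE h (finFunctionFinEquiv.symm (i v) j))) := by
  funext i
  simp only [tetra, Equiv.symm_apply_apply]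
  refine if_congr ?_ rfl rfl
  simp only [consistent_iff, (Fin.castLE_injective h).eq_iff]

/-- **Monotonicity in the level**: `R₄(T(K₄)_m) ≤ R₄(T(K₄)_{m'})` for `m ≤ m'`. [folklore] -/
theorem tensorRankD_tetra_mono {m m' : ℕ} (h : m ≤ m') :
    tensorRankD (tetra F m) ≤ tensorRankD (tetra F m') := by
  rw [tetra_eq_pullback (F := F) h]
  exact tensorRankD_pullback_le (tetra F m')
    (fun _ x => finFunctionFinEquiv (fun j => Fin.castLE h (finFunctionFinEquiv.symm x j)))
    (tetra_decomposable m')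

/-- `R₄(T(K₄)_m) ≤ R(⟨N,N,N⟩)⁴` with `N = ⌊√m⌋ + 1`. [cite: ChristandlVranaZuiddam2016, Prop. 1.1.26] -/
theorem tensorRankD_tetra_le_pow_four (m : ℕ) :
    tensorRankD (tetra F m) ≤ tensorRank (matMulTensor F (Nat.sqrt m + 1) (Nat.sqrt m + 1) (Nat.sqrt m + 1)) ^ 4 :=
  (tensorRankD_tetra_mono ((Nat.le_succ m).trans (Nat.succ_le_succ_sqrt m))).trans
    (tensorRankD_tetra_sq_le _)

/-- If `β` is an admissible exponent for `⟨n,n,n⟩`, then `2β` is admissible for the tetrahedron.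
[cite: ChristandlVranaZuiddam2016, Prop. 1.1.26] -/
theorem two_mul_mem_tetraAdmissibleExponents {β : ℝ} (hβ : β ∈ admissibleExponents F) :
    2 * β ∈ tetraAdmissibleExponents F := by
  have hβ2 : 2 ≤ β := admissibleExponents_two_le F hβ
  obtain ⟨C, hC⟩ := isBigO_iff.1 hβ
  obtain ⟨N₀, hN₀⟩ := eventually_atTop.1 hC
  -- the constant
  refine IsBigO.of_bound (C ^ 4 * (4 : ℝ) ^ (2 * β)) ?_
  filter_upwards [eventually_ge_atTop (max 1 (N₀ * N₀))] with m hm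
  have hm1 : 1 ≤ m := le_trans (le_max_left _ _) hm
  have hmN : N₀ * N₀ ≤ m := le_trans (le_max_right _ _) hm
  set N := Nat.sqrt m + 1 with hNdef
  have hN₀N : N₀ ≤ N := by
    have : N₀ ≤ Nat.sqrt m := Nat.le_sqrt.2 hmN
    omega
  -- the bound at `N`
  have hRN := hN₀ N hN₀N
  rw [Real.norm_of_nonneg (Nat.cast_nonneg _),
    Real.norm_of_nonneg (Real.rpow_nonneg (Nat.cast_nonneg _) _)] at hRN
  have hC0 : 0 ≤ C := by
    have h1 : (0 : ℝ) ≤ (tensorRank (matMulTensor F N N N) : ℝ) := Nat.cast_nonneg _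
    have h2 : (0 : ℝ) < (N : ℝ) ^ β := Real.rpow_pos_of_pos (by positivity) _
    nlinarith [hRN, h2]
  rw [Real.norm_of_nonneg (Nat.cast_nonneg _),
    Real.norm_of_nonneg (Real.rpow_nonneg (Nat.cast_nonneg _) _)]
  -- naturals: R₄(T_m) ≤ R(⟨N,N,N⟩)^4 and N·N ≤ 4m
  have hnat := tensorRankD_tetra_le_pow_four (F := F) m
  have hNN : N * N ≤ 4 * m := by
    have hs : 1 ≤ Nat.sqrt m := Nat.le_sqrt.2 (by simpa using hm1)
    have hs2 : Nat.sqrt m * Nat.sqrt m ≤ m := Nat.sqrt_le m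
    nlinarith [hs, hs2]
  have hN0 : (0 : ℝ) ≤ N := Nat.cast_nonneg _
  have step1 : (tensorRankD (tetra F m) : ℝ) ≤ (C * (N : ℝ) ^ β) ^ 4 := by
    calc (tensorRankD (tetra F m) : ℝ)
        ≤ ((tensorRank (matMulTensor F N N N) : ℝ)) ^ 4 := by exact_mod_cast hnat
      _ ≤ (C * (N : ℝ) ^ β) ^ 4 := pow_le_pow_left₀ (Nat.cast_nonneg _) hRN 4
  have step2 : ((N : ℝ) ^ β) ^ 4 ≤ (4 : ℝ) ^ (2 * β) * (m : ℝ) ^ (2 * β) := by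
    have hββ : 0 ≤ 2 * β := by linarith
    calc ((N : ℝ) ^ β) ^ 4 = ((N : ℝ) ^ (2 : ℝ)) ^ (2 * β) := by
            rw [← Real.rpow_natCast ((N : ℝ) ^ β) 4, ← Real.rpow_mul hN0, ← Real.rpow_mul hN0]
            norm_num
            ring_nf
      _ ≤ ((4 * m : ℕ) : ℝ) ^ (2 * β) := by
            refine Real.rpow_le_rpow (by positivity) ?_ hββ
            rw [Real.rpow_two]
            exact_mod_cast (by simpa [sq] using hNN : N ^ 2 ≤ 4 * m)
      _ = (4 : ℝ) ^ (2 * β) * (m : ℝ) ^ (2 * β) := by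
            push_cast
            exact Real.mul_rpow (by norm_num) (Nat.cast_nonneg _)
  calc (tensorRankD (tetra F m) : ℝ) ≤ (C * (N : ℝ) ^ β) ^ 4 := step1
    _ = C ^ 4 * ((N : ℝ) ^ β) ^ 4 := mul_pow _ _ _
    _ ≤ C ^ 4 * ((4 : ℝ) ^ (2 * β) * (m : ℝ) ^ (2 * β)) :=
          mul_le_mul_of_nonneg_left step2 (pow_nonneg hC0 4)
    _ = C ^ 4 * (4 : ℝ) ^ (2 * β) * (m : ℝ) ^ (2 * β) := by ring

/-- **The triangle cover `ω(K₄) ≤ 2ω`** (CVZ19 Prop. 1.1.26, `k = 4, ℓ = 3`), for every field.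
[cite: ChristandlVranaZuiddam2016, Prop. 1.1.26] -/
theorem omegaTetra_le_two_mul_omega (F : Type*) [Field F] : omegaTetra F ≤ 2 * omega F := by
  have h : ∀ β ∈ admissibleExponents F, omegaTetra F / 2 ≤ β := fun β hβ => by
    have := csInf_le (tetraAdmissibleExponents_bddBelow F) (two_mul_mem_tetraAdmissibleExponents hβ)
    change omegaTetra F ≤ 2 * β at this
    linarith
  have h2 : omegaTetra F / 2 ≤ omega F := le_csInf (admissibleExponents_nonempty F) h
  linarith

end Cover

/-! ## Against the summit `ω(ℂ) = 2`: necessity of both halves, sufficiency, exactness -/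

/-- NEC of the «no saving» half, kernel: `ω = 2 ⟹ 2ω = 4 ≤ ω(K₄)` (flattening).
[cite: ChristandlVranaZuiddam2016, §1.3] -/
theorem two_mul_omega_le_omegaTetra_of_matrixMultiplication (hS : _root_.MatrixMultiplication) :
    2 * omega ℂ ≤ omegaTetra ℂ := by
  have hω : omega ℂ = 2 := (_root_.MatrixMultiplication_iff).1 hS
  rw [hω]
  have := four_le_omegaTetra ℂ
  linarith

/-- NEC of the «flat» half, kernel: `ω = 2 ⟹ ω(K₄) ≤ 2ω = 4` (triangle cover); CVZ19 §1.3: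
«if `ω = 2` then `τ(T(K₃)) = τ(T(K₄)) = 2/3`». [cite: ChristandlVranaZuiddam2016, §1.3] -/
theorem omegaTetra_le_four_of_matrixMultiplication (hS : _root_.MatrixMultiplication) :
    omegaTetra ℂ ≤ 4 := by
  have hω : omega ℂ = 2 := (_root_.MatrixMultiplication_iff).1 hS
  have hcov := omegaTetra_le_two_mul_omega ℂ
  rw [hω] at hcov
  linarith

/-- SUFFICIENCY: `ω(K₄) ≤ 4` and `2ω ≤ ω(K₄)` give `ω ≤ 2`, and `2 ≤ ω` is the flattening bound
`omega_two_le`. [folklore] -/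
theorem matrixMultiplication_of_tetra (hA : omegaTetra ℂ ≤ 4) (hB : 2 * omega ℂ ≤ omegaTetra ℂ) :
    _root_.MatrixMultiplication := by
  refine (_root_.MatrixMultiplication_iff).2 (le_antisymm ?_ (omega_two_le ℂ))
  linarith

/-- **EXACT CUT (kernel)**: `ω(ℂ) = 2 ⟺ [ω(K₄) ≤ 4] ∧ [2ω ≤ ω(K₄)]` — the tetrahedron sits at its
flattening exponent AND nothing is saved over two triangles. [cite: ChristandlVranaZuiddam2016, §1.3] -/
theorem matrixMultiplication_iff_tetra :
    _root_.MatrixMultiplication ↔ (omegaTetra ℂ ≤ 4 ∧ 2 * omega ℂ ≤ omegaTetra ℂ) :=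
  ⟨fun hS => ⟨omegaTetra_le_four_of_matrixMultiplication hS,
      two_mul_omega_le_omegaTetra_of_matrixMultiplication hS⟩,
    fun h => matrixMultiplication_of_tetra h.1 h.2⟩

/-- The «flat» half is the VALUE statement `ω(K₄) = 4`. [cite: ChristandlVranaZuiddam2016, §1.2] -/
theorem omegaTetra_le_four_iff : omegaTetra ℂ ≤ 4 ↔ omegaTetra ℂ = 4 :=
  ⟨fun h => le_antisymm h (four_le_omegaTetra ℂ), fun h => h.le⟩

/-- The «no saving» half is the VALUE statement `ω(K₄) = 2ω`. [cite: ChristandlVranaZuiddam2016, Prop. 1.1.26] -/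
theorem two_mul_omega_le_omegaTetra_iff : 2 * omega ℂ ≤ omegaTetra ℂ ↔ omegaTetra ℂ = 2 * omega ℂ :=
  ⟨fun h => le_antisymm (omegaTetra_le_two_mul_omega ℂ) h, fun h => h.ge⟩

/-- The kernel bracket `4 ≤ ω(K₄) ≤ 2ω` over `ℂ`. [cite: ChristandlVranaZuiddam2016, §1.2 (table)] -/
theorem omegaTetra_bracket : 4 ≤ omegaTetra ℂ ∧ omegaTetra ℂ ≤ 2 * omega ℂ :=
  ⟨four_le_omegaTetra ℂ, omegaTetra_le_two_mul_omega ℂ⟩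

end Summit.MatrixMultiplication.MatrixMultiplication.Theorems.TetrahedronTensor

end
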